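import Literature.Geometry.Lorentzian.GerochMonotonicityIntegrability
import Literature.Geometry.Lorentzian.InverseMeanCurvatureFlowArea
import HarnessLib

/-!
# Joint regularity of the normal, the second fundamental form and the mean curvature
# along a classical inverse mean curvature flow

A classical solution `IsClassicalIMCF h hpb F ν a b` (`InverseMeanCurvatureFlow.lean`) records
that the flow map `(t, y) ↦ F t y` is jointly smooth on `(a, b) × S`, that each `F t` is a
spacelike immersion with a unit normal field `ν t` which is smooth in `y`, `H > 0`, and the flow
equation `∂_t F = H⁻¹ ν` (Huisken–Ilmanen 2001, §0 (∗): "a smooth family"). The Monotonicity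
Calculation (§5) differentiates `∫_{N_t} H² dμ_t` in `t`, which needs the mean curvature to be
jointly `C¹` in `(t, y)` (`IsClassicalIMCF.hasDerivAt_sqMeanCurvatureIntegral`,
`GerochMonotonicityVariation.lean`, hypothesis `hreg`). This file proves that joint regularity:

* `IsClassicalIMCF.contMDiffAt_lift_normal_chartFlow` — the unit normal is jointly smooth: read
  through the chart flow map `P(t, u) = F t (φ⁻¹ u)` it is a `C^∞` map into `TX`, because
  `ν = ∂_t F / |∂_t F|_h` by the flow equation and `|ν| = 1`, `H > 0`;
* `IsClassicalIMCF.contMDiffAt_secondFundamentalForm_chartFlow` — `(t, u) ↦ K_{ν_t}(∂ₐ, ∂_c)(φ⁻¹ u)`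
  is `C^∞` (the frame formula `secondFundamentalForm_apply_eq_frame` with all factors jointly
  smooth);
* `IsClassicalIMCF.contMDiffAt_meanCurvature_chartFlow`, `contDiffOn_meanCurvature_chart` — the
  mean curvature is jointly `C^∞`: `(t, u) ↦ H_t(φ⁻¹ u)` is `C^∞` on `(a, b) × φ.target` for every
  chart `φ` of `S` (`H = ∑ (𝒢⁻¹)_{ca} K(∂ₐ, ∂_c)`).

Generic lemmas: `contMDiffAt_lift_mfderiv_const` (the differential of a smooth map from a normed
space on a constant vector is a smooth map into the tangent bundle), `contMDiffAt_lift_smul`.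
The domain of the chart flow map is the normed space `ℝ × ℝ²`, so that no tangent bundle of a
product manifold is needed: time and space derivatives are `dP(1, 0)` and `dP(0, e_c)`
(`velocity_eq_mfderiv_chartFlow`, `mfderiv_localFrame_eq_mfderiv_chartFlow`).

Everything is proved; there are no definitions and no named facts.

## References

* G. Huisken, T. Ilmanen, *The inverse mean curvature flow and the Riemannian Penrose
  inequality*, J. Differential Geom. 59 (2001) 353–437: §0 (∗), §5.
* B. O'Neill, *Semi-Riemannian geometry*, Academic Press 1983, Ch. 4, Lemma 4.
-/

noncomputable section

open Bundle Set Manifold TopologicalSpace Filter MeasureTheory Function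
open scoped ContDiff Topology Manifold

namespace Literature.Geometry.Lorentzian

open PseudoRiemannianMetric

/-! ### Lifts `q ↦ (P q, dP_q v₀)` and `q ↦ (P q, c(q) W(q))` from a normed space -/

section Lift

variable {E : Type*} [NormedAddCommGroup E] [NormedSpace ℝ E] {H : Type*} [TopologicalSpace H]
  {I : ModelWithCorners ℝ E H} {M : Type*} [TopologicalSpace M] [ChartedSpace H M]
  [IsManifold I ∞ M] {V : Type*} [NormedAddCommGroup V] [NormedSpace ℝ V]

/-- **The differential of a smooth map from a normed space, on a constant vector, is a smooth map
into the tangent bundle.** For `P : V → M` of class `C^∞` on an open set `D` of a normed space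
`V` and `v₀ ∈ V`, `q ↦ (P q, dP_q v₀) ∈ TM` is `C^∞` at every `q ∈ D`: in the trivialisation of `TM`
at `P q` its fibre coordinate is `D(φ ∘ P)_q v₀`, the derivative of the `C^∞` chart expression.
[folklore] -/
theorem contMDiffAt_lift_mfderiv_const {P : V → M} {D : Set V} (hD : IsOpen D)
    (hP : ContMDiffOn 𝓘(ℝ, V) I ∞ P D) {q : V} (hq : q ∈ D) (v₀ : V) :
    ContMDiffAt 𝓘(ℝ, V) I.tangent ∞ (fun q' ↦ (TotalSpace.mk' E (P q')
      (mfderiv 𝓘(ℝ, V) I P q' v₀) : TangentBundle I M)) q := by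
  set x₁ := P q with hx₁
  have hI1 : IsManifold I (∞ + 1) M := inferInstanceAs (IsManifold I ∞ M)
  have hVB : ContMDiffVectorBundle ∞ E (TangentSpace I : M → Type _) I :=
    TangentBundle.contMDiffVectorBundle
  have hPq : ContMDiffAt 𝓘(ℝ, V) I ∞ P q := hP.contMDiffAt (hD.mem_nhds hq)
  have hsrc : (TotalSpace.mk' E (P q) (mfderiv 𝓘(ℝ, V) I P q v₀) : TangentBundle I M) ∈
      (trivializationAt E (TangentSpace I : M → Type _) x₁).source := by
    rw [Trivialization.mem_source]; exact FiberBundle.mem_baseSet_trivializationAt' x₁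
  refine ((trivializationAt E (TangentSpace I : M → Type _) x₁).contMDiffAt_iff
    (f := fun q' ↦ (TotalSpace.mk' E (P q') (mfderiv 𝓘(ℝ, V) I P q' v₀) : TangentBundle I M))
    hsrc).2 ⟨hPq, ?_⟩
  -- the set where `P` lands in the chart domain of `x₁`
  set D' : Set V := D ∩ P ⁻¹' (chartAt H x₁).source with hD'
  have hD'o : IsOpen D' := hP.continuousOn.isOpen_inter_preimage hD (chartAt H x₁).open_source
  have hqD' : q ∈ D' := ⟨hq, mem_chart_source H x₁⟩
  -- the chart expression and its derivative
  have hΨ : ContDiffOn ℝ ∞ (extChartAt I x₁ ∘ P) D' := by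
    rw [← contMDiffOn_iff_contDiffOn]
    exact contMDiffOn_extChartAt.comp (hP.mono inter_subset_left) fun q' hq' ↦ hq'.2
  have hdΨ : ContDiffOn ℝ ∞ (fun q' ↦ fderiv ℝ (extChartAt I x₁ ∘ P) q' v₀) D' :=
    (hΨ.fderiv_of_isOpen hD'o le_rfl).clm_apply contDiffOn_const
  have hev : (fun q' ↦ ((trivializationAt E (TangentSpace I : M → Type _) x₁)
      (TotalSpace.mk' E (P q') (mfderiv 𝓘(ℝ, V) I P q' v₀) : TangentBundle I M)).2) =ᶠ[𝓝 q]
      fun q' ↦ fderiv ℝ (extChartAt I x₁ ∘ P) q' v₀ := by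
    filter_upwards [hD'o.mem_nhds hqD'] with q' hq'
    have hPq' : MDifferentiableAt 𝓘(ℝ, V) I P q' :=
      (hP.contMDiffAt (hD.mem_nhds hq'.1)).mdifferentiableAt (by simp)
    have h1 := (mdifferentiableAt_extChartAt hq'.2).hasMFDerivAt.comp q' hPq'.hasMFDerivAt
    set L : V →L[ℝ] E := (mfderiv I 𝓘(ℝ, E) (extChartAt I x₁) (P q')).comp
      (mfderiv 𝓘(ℝ, V) I P q') with hL
    have h2 : HasFDerivAt (extChartAt I x₁ ∘ P) L q' := hasMFDerivAt_iff_hasFDerivAt.1 h1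
    rw [← Trivialization.continuousLinearMapAt_apply_of_mem ℝ _ (by simpa using hq'.2),
      TangentBundle.continuousLinearMapAt_trivializationAt hq'.2, h2.fderiv]
    rfl
  refine ContMDiffAt.congr_of_eventuallyEq ?_ hev
  exact (contMDiffOn_iff_contDiffOn.2 hdΨ).contMDiffAt (hD'o.mem_nhds hqD')

/-- **Rescaling a smooth map into the tangent bundle by a smooth function.** If
`q ↦ (P q, W q) ∈ TM` and `c : V → ℝ` are `C^n` at `q`, so is `q ↦ (P q, c(q) W(q))` (read in the
trivialisation at `P q`, whose fibre maps are linear). [folklore] -/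
theorem contMDiffAt_lift_smul {P : V → M} {W : Π q : V, TangentSpace I (P q)}
    {c : V → ℝ} {q : V}
    (hW : ContMDiffAt 𝓘(ℝ, V) I.tangent ∞
      (fun q' ↦ (TotalSpace.mk' E (P q') (W q') : TangentBundle I M)) q)
    (hc : ContMDiffAt 𝓘(ℝ, V) 𝓘(ℝ, ℝ) ∞ c q) :
    ContMDiffAt 𝓘(ℝ, V) I.tangent ∞
      (fun q' ↦ (TotalSpace.mk' E (P q') (c q' • W q') : TangentBundle I M)) q := by
  set x₁ := P q with hx₁
  have hI1 : IsManifold I (∞ + 1) M := inferInstanceAs (IsManifold I ∞ M)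
  have hVB : ContMDiffVectorBundle ∞ E (TangentSpace I : M → Type _) I :=
    TangentBundle.contMDiffVectorBundle
  have hsrc : ∀ w : TangentSpace I (P q), (TotalSpace.mk' E (P q) w : TangentBundle I M) ∈
      (trivializationAt E (TangentSpace I : M → Type _) x₁).source := fun w ↦ by
    rw [Trivialization.mem_source]; exact FiberBundle.mem_baseSet_trivializationAt' x₁
  obtain ⟨hP, hWc⟩ := ((trivializationAt E (TangentSpace I : M → Type _) x₁).contMDiffAt_iff
    (f := fun q' ↦ (TotalSpace.mk' E (P q') (W q') : TangentBundle I M)) (hsrc _)).1 hW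
  refine ((trivializationAt E (TangentSpace I : M → Type _) x₁).contMDiffAt_iff
    (f := fun q' ↦ (TotalSpace.mk' E (P q') (c q' • W q') : TangentBundle I M)) (hsrc _)).2
    ⟨hP, ?_⟩
  have hnear : ∀ᶠ q' in 𝓝 q, P q' ∈ (chartAt H x₁).source :=
    hP.continuousAt.preimage_mem_nhds ((chartAt H x₁).open_source.mem_nhds
      (mem_chart_source H x₁))
  have hev : (fun q' ↦ ((trivializationAt E (TangentSpace I : M → Type _) x₁)
      (TotalSpace.mk' E (P q') (c q' • W q') : TangentBundle I M)).2) =ᶠ[𝓝 q]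
      fun q' ↦ c q' • ((trivializationAt E (TangentSpace I : M → Type _) x₁)
        (TotalSpace.mk' E (P q') (W q') : TangentBundle I M)).2 := by
    filter_upwards [hnear] with q' hq'
    have hq'e : P q' ∈ (trivializationAt E (TangentSpace I : M → Type _) x₁).baseSet := by
      simpa using hq'
    rw [← Trivialization.continuousLinearMapAt_apply_of_mem ℝ _ hq'e,
      ← Trivialization.continuousLinearMapAt_apply_of_mem ℝ _ hq'e, map_smul]
  exact (hc.smul hWc).congr_of_eventuallyEq hev

end Lift


/-! ### The flow map in a chart of `S`: `P(t, u) = F t (φ⁻¹ u)` -/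

section Flow

variable {X : Type*} [TopologicalSpace X] [ChartedSpace E3 X] [IsManifold (𝓡 3) ∞ X]
  {h : ContMDiffRiemannianMetric (𝓡 3) ∞ E3 (TangentSpace (𝓡 3) : X → Type _)}
  [(ofRiemannian h).HasLeviCivita]
  {S : Type*} [TopologicalSpace S] [ChartedSpace (EuclideanSpace ℝ (Fin 2)) S]
  [IsManifold (𝓡 2) ∞ S] {hpb : contMDiff_pullbackBilin (𝓡 3) X (𝓡 2) S ∞}
  {F : ℝ → S → X} {ν : (t : ℝ) → NormalField (𝓡 3) (F t)} {a b : ℝ} {y₀ : S}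

namespace IsClassicalIMCF

/-- **The flow map read in a chart of `S` is smooth**: `(t, u) ↦ F t (φ⁻¹ u)`, `φ` the extended
chart of `S` at `y₀`, is `C^∞` on `(a, b) × φ.target` (as a map from the normed space `ℝ × ℝ²`).
[cite: HuiskenIlmanenIMCF2001, §0 (∗)] -/
theorem contMDiffOn_chartFlow (Hc : IsClassicalIMCF h hpb F ν a b) :
    ContMDiffOn 𝓘(ℝ, ℝ × EuclideanSpace ℝ (Fin 2)) (𝓡 3) ∞
      (fun q : ℝ × EuclideanSpace ℝ (Fin 2) ↦ F q.1 ((extChartAt (𝓡 2) y₀).symm q.2))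
      (Set.Ioo a b ×ˢ (extChartAt (𝓡 2) y₀).target) := by
  have hG : ContMDiffOn (𝓘(ℝ, ℝ).prod 𝓘(ℝ, EuclideanSpace ℝ (Fin 2))) (𝓘(ℝ, ℝ).prod (𝓡 2)) ∞
      (fun q : ℝ × EuclideanSpace ℝ (Fin 2) ↦ ((q.1, (extChartAt (𝓡 2) y₀).symm q.2) : ℝ × S))
      (Set.Ioo a b ×ˢ (extChartAt (𝓡 2) y₀).target) :=
    contMDiffOn_fst.prodMk ((contMDiffOn_extChartAt_symm y₀).comp contMDiffOn_snd
      fun q hq ↦ hq.2)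
  have hmaps : MapsTo (fun q : ℝ × EuclideanSpace ℝ (Fin 2) ↦
      ((q.1, (extChartAt (𝓡 2) y₀).symm q.2) : ℝ × S))
      (Set.Ioo a b ×ˢ (extChartAt (𝓡 2) y₀).target) (Set.Ioo a b ×ˢ univ) :=
    fun q hq ↦ ⟨hq.1, mem_univ _⟩
  have h1 : ContMDiffOn (𝓘(ℝ, ℝ).prod 𝓘(ℝ, EuclideanSpace ℝ (Fin 2))) (𝓡 3) ∞
      (fun q : ℝ × EuclideanSpace ℝ (Fin 2) ↦ F q.1 ((extChartAt (𝓡 2) y₀).symm q.2))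
      (Set.Ioo a b ×ˢ (extChartAt (𝓡 2) y₀).target) := Hc.contMDiffOn.comp hG hmaps
  rw [modelWithCornersSelf_prod, ← chartedSpaceSelf_prod]
  exact h1

omit [IsManifold (𝓡 3) ∞ X] [(ofRiemannian h).HasLeviCivita] [IsManifold (𝓡 2) ∞ S] in
/-- The time derivative `∂_t F` at `(t, φ⁻¹ u)` is the differential of the chart flow map on
`(1, 0)`. [folklore] -/
theorem velocity_eq_mfderiv_chartFlow {t : ℝ} {u : EuclideanSpace ℝ (Fin 2)}
    (hP : MDifferentiableAt 𝓘(ℝ, ℝ × EuclideanSpace ℝ (Fin 2)) (𝓡 3)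
      (fun q : ℝ × EuclideanSpace ℝ (Fin 2) ↦ F q.1 ((extChartAt (𝓡 2) y₀).symm q.2)) (t, u)) :
    velocity (𝓡 3) (fun s ↦ F s ((extChartAt (𝓡 2) y₀).symm u)) t =
      mfderiv 𝓘(ℝ, ℝ × EuclideanSpace ℝ (Fin 2)) (𝓡 3)
        (fun q : ℝ × EuclideanSpace ℝ (Fin 2) ↦ F q.1 ((extChartAt (𝓡 2) y₀).symm q.2)) (t, u)
        ((1 : ℝ), (0 : EuclideanSpace ℝ (Fin 2))) := by
  have hι : HasMFDerivAt 𝓘(ℝ, ℝ) 𝓘(ℝ, ℝ × EuclideanSpace ℝ (Fin 2))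
      (fun s : ℝ ↦ ((s, u) : ℝ × EuclideanSpace ℝ (Fin 2))) t
      (ContinuousLinearMap.inl ℝ ℝ (EuclideanSpace ℝ (Fin 2))) :=
    ((ContinuousLinearMap.inl ℝ ℝ (EuclideanSpace ℝ (Fin 2))).hasFDerivAt.add_const
      ((0 : ℝ), u) |>.congr_of_eventuallyEq (Eventually.of_forall fun s ↦ by simp)).hasMFDerivAt
  have hc : HasMFDerivAt 𝓘(ℝ, ℝ) (𝓡 3) (fun s ↦ F s ((extChartAt (𝓡 2) y₀).symm u)) t
      ((mfderiv 𝓘(ℝ, ℝ × EuclideanSpace ℝ (Fin 2)) (𝓡 3)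
        (fun q : ℝ × EuclideanSpace ℝ (Fin 2) ↦ F q.1 ((extChartAt (𝓡 2) y₀).symm q.2))
        (t, u)).comp (ContinuousLinearMap.inl ℝ ℝ (EuclideanSpace ℝ (Fin 2)))) :=
    hP.hasMFDerivAt.comp t hι
  rw [velocity, hc.mfderiv]
  rfl

omit [IsManifold (𝓡 3) ∞ X] [(ofRiemannian h).HasLeviCivita] in
/-- The spatial derivative `dF_t(∂_c)` at `φ⁻¹ u` (`∂_c` the coordinate frame of the chart of `S`
at `y₀`, for a basis `b₂` of `ℝ²`) is the differential of the chart flow map on `(0, e_c)`.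
[folklore] -/
theorem mfderiv_localFrame_eq_mfderiv_chartFlow {ι : Type*} (b₂ : Module.Basis ι ℝ
      (EuclideanSpace ℝ (Fin 2))) {t : ℝ} {u : EuclideanSpace ℝ (Fin 2)}
    (hu : u ∈ (extChartAt (𝓡 2) y₀).target)
    (hFt : MDifferentiableAt (𝓡 2) (𝓡 3) (F t) ((extChartAt (𝓡 2) y₀).symm u))
    (hP : MDifferentiableAt 𝓘(ℝ, ℝ × EuclideanSpace ℝ (Fin 2)) (𝓡 3)
      (fun q : ℝ × EuclideanSpace ℝ (Fin 2) ↦ F q.1 ((extChartAt (𝓡 2) y₀).symm q.2)) (t, u))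
    (c : ι) :
    mfderiv (𝓡 2) (𝓡 3) (F t) ((extChartAt (𝓡 2) y₀).symm u)
        ((trivializationAt (EuclideanSpace ℝ (Fin 2)) (TangentSpace (𝓡 2)) y₀).localFrame b₂ c
          ((extChartAt (𝓡 2) y₀).symm u)) =
      mfderiv 𝓘(ℝ, ℝ × EuclideanSpace ℝ (Fin 2)) (𝓡 3)
        (fun q : ℝ × EuclideanSpace ℝ (Fin 2) ↦ F q.1 ((extChartAt (𝓡 2) y₀).symm q.2)) (t, u)
        ((0 : ℝ), b₂ c) := by
  have hsrc : (extChartAt (𝓡 2) y₀).symm u ∈ (chartAt (EuclideanSpace ℝ (Fin 2)) y₀).source := by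
    rw [← extChartAt_source (𝓡 2)]; exact (extChartAt (𝓡 2) y₀).map_target hu
  have hframe : (trivializationAt (EuclideanSpace ℝ (Fin 2)) (TangentSpace (𝓡 2)) y₀).localFrame
      b₂ c ((extChartAt (𝓡 2) y₀).symm u) =
      mfderiv 𝓘(ℝ, EuclideanSpace ℝ (Fin 2)) (𝓡 2) (extChartAt (𝓡 2) y₀).symm u (b₂ c) := by
    rw [localFrame_apply_eq_mfderivWithin_symm b₂ hsrc c, (extChartAt (𝓡 2) y₀).right_inv hu,
      ModelWithCorners.Boundaryless.range_eq_univ, mfderivWithin_univ]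
  have hsymm : MDifferentiableAt 𝓘(ℝ, EuclideanSpace ℝ (Fin 2)) (𝓡 2)
      (extChartAt (𝓡 2) y₀).symm u :=
    ((contMDiffOn_extChartAt_symm (n := 1) y₀).contMDiffAt
      ((isOpen_extChartAt_target y₀).mem_nhds hu)).mdifferentiableAt one_ne_zero
  -- both sides are the differential of `u' ↦ F t (φ⁻¹ u')` on `b₂ c`
  have h1 : HasMFDerivAt 𝓘(ℝ, EuclideanSpace ℝ (Fin 2)) (𝓡 3)
      (fun u' ↦ F t ((extChartAt (𝓡 2) y₀).symm u')) u
      ((mfderiv (𝓡 2) (𝓡 3) (F t) ((extChartAt (𝓡 2) y₀).symm u)).comp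
        (mfderiv 𝓘(ℝ, EuclideanSpace ℝ (Fin 2)) (𝓡 2) (extChartAt (𝓡 2) y₀).symm u)) :=
    hFt.hasMFDerivAt.comp u hsymm.hasMFDerivAt
  have hι : HasMFDerivAt 𝓘(ℝ, EuclideanSpace ℝ (Fin 2)) 𝓘(ℝ, ℝ × EuclideanSpace ℝ (Fin 2))
      (fun u' : EuclideanSpace ℝ (Fin 2) ↦ ((t, u') : ℝ × EuclideanSpace ℝ (Fin 2))) u
      (ContinuousLinearMap.inr ℝ ℝ (EuclideanSpace ℝ (Fin 2))) :=
    ((ContinuousLinearMap.inr ℝ ℝ (EuclideanSpace ℝ (Fin 2))).hasFDerivAt.add_const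
      ((t, (0 : EuclideanSpace ℝ (Fin 2))) : ℝ × EuclideanSpace ℝ (Fin 2))
      |>.congr_of_eventuallyEq (Eventually.of_forall fun s ↦ by simp)).hasMFDerivAt
  have h2 : HasMFDerivAt 𝓘(ℝ, EuclideanSpace ℝ (Fin 2)) (𝓡 3)
      (fun u' ↦ F t ((extChartAt (𝓡 2) y₀).symm u')) u
      ((mfderiv 𝓘(ℝ, ℝ × EuclideanSpace ℝ (Fin 2)) (𝓡 3)
        (fun q : ℝ × EuclideanSpace ℝ (Fin 2) ↦ F q.1 ((extChartAt (𝓡 2) y₀).symm q.2))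
        (t, u)).comp (ContinuousLinearMap.inr ℝ ℝ (EuclideanSpace ℝ (Fin 2)))) :=
    hP.hasMFDerivAt.comp u hι
  have heq := h1.mfderiv.symm.trans h2.mfderiv
  have := congrArg (fun L : EuclideanSpace ℝ (Fin 2) →L[ℝ] E3 ↦ L (b₂ c)) heq
  rw [hframe]
  exact this

/-- **The unit normal of a classical solution is jointly smooth in `(t, y)`**, read through the
chart flow map: `(t, u) ↦ (F t (φ⁻¹ u), ν_t(φ⁻¹ u)) ∈ TX` is `C^∞` on `(a, b) × φ.target`. Indeed
by the flow equation `∂_t F = H⁻¹ ν` and `|ν| = 1`, `ν = ∂_t F / |∂_t F|_h`, where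
`∂_t F = dP(1, 0)` is a smooth map into `TX` (`contMDiffAt_lift_mfderiv_const`) of nowhere
vanishing length (`H > 0`). (The structure `IsClassicalIMCF` only records smoothness of each
`ν_t`; joint smoothness is a consequence of (∗).) [cite: HuiskenIlmanenIMCF2001, §0 (∗)] -/
theorem contMDiffAt_lift_normal_chartFlow (Hc : IsClassicalIMCF h hpb F ν a b)
    {q : ℝ × EuclideanSpace ℝ (Fin 2)} (hq : q ∈ Set.Ioo a b ×ˢ (extChartAt (𝓡 2) y₀).target) :
    ContMDiffAt 𝓘(ℝ, ℝ × EuclideanSpace ℝ (Fin 2)) (𝓡 3).tangent ∞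
      (fun q' : ℝ × EuclideanSpace ℝ (Fin 2) ↦ (TotalSpace.mk' E3
        (F q'.1 ((extChartAt (𝓡 2) y₀).symm q'.2)) (ν q'.1 ((extChartAt (𝓡 2) y₀).symm q'.2)) :
          TangentBundle (𝓡 3) X)) q := by
  have hD : IsOpen (Set.Ioo a b ×ˢ (extChartAt (𝓡 2) y₀).target) :=
    isOpen_Ioo.prod (isOpen_extChartAt_target y₀)
  have hP := Hc.contMDiffOn_chartFlow (y₀ := y₀)
  have hW := contMDiffAt_lift_mfderiv_const hD hP hq ((1 : ℝ), (0 : EuclideanSpace ℝ (Fin 2)))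
  -- `∂_t F = H⁻¹ ν` along the chart flow
  have hvel : ∀ (q' : ℝ × EuclideanSpace ℝ (Fin 2))
      (hq' : q' ∈ Set.Ioo a b ×ˢ (extChartAt (𝓡 2) y₀).target),
      mfderiv 𝓘(ℝ, ℝ × EuclideanSpace ℝ (Fin 2)) (𝓡 3)
        (fun q : ℝ × EuclideanSpace ℝ (Fin 2) ↦ F q.1 ((extChartAt (𝓡 2) y₀).symm q.2)) q'
        ((1 : ℝ), (0 : EuclideanSpace ℝ (Fin 2))) =
      ((ofRiemannian h).meanCurvature (F q'.1) hpb (Hc.isSpacelikeImmersion q'.1 hq'.1)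
        (ν q'.1) ((extChartAt (𝓡 2) y₀).symm q'.2))⁻¹ •
        ν q'.1 ((extChartAt (𝓡 2) y₀).symm q'.2) := by
    rintro ⟨t, u⟩ hq'
    have hPd : MDifferentiableAt 𝓘(ℝ, ℝ × EuclideanSpace ℝ (Fin 2)) (𝓡 3)
        (fun q : ℝ × EuclideanSpace ℝ (Fin 2) ↦ F q.1 ((extChartAt (𝓡 2) y₀).symm q.2)) (t, u) :=
      (hP.contMDiffAt (hD.mem_nhds hq')).mdifferentiableAt (by simp)
    rw [← velocity_eq_mfderiv_chartFlow hPd]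
    exact Hc.velocity_eq t hq'.1 _
  -- `|∂_t F|²_h = H⁻²`
  have hWW : ∀ (q' : ℝ × EuclideanSpace ℝ (Fin 2))
      (hq' : q' ∈ Set.Ioo a b ×ˢ (extChartAt (𝓡 2) y₀).target),
      (ofRiemannian h).val (F q'.1 ((extChartAt (𝓡 2) y₀).symm q'.2))
        (mfderiv 𝓘(ℝ, ℝ × EuclideanSpace ℝ (Fin 2)) (𝓡 3)
          (fun q : ℝ × EuclideanSpace ℝ (Fin 2) ↦ F q.1 ((extChartAt (𝓡 2) y₀).symm q.2)) q'
          ((1 : ℝ), (0 : EuclideanSpace ℝ (Fin 2))))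
        (mfderiv 𝓘(ℝ, ℝ × EuclideanSpace ℝ (Fin 2)) (𝓡 3)
          (fun q : ℝ × EuclideanSpace ℝ (Fin 2) ↦ F q.1 ((extChartAt (𝓡 2) y₀).symm q.2)) q'
          ((1 : ℝ), (0 : EuclideanSpace ℝ (Fin 2)))) =
      ((ofRiemannian h).meanCurvature (F q'.1) hpb (Hc.isSpacelikeImmersion q'.1 hq'.1)
        (ν q'.1) ((extChartAt (𝓡 2) y₀).symm q'.2))⁻¹ ^ 2 := by
    intro q' hq'
    rw [hvel q' hq']
    simp only [map_smul, FunLike.coe_smul, Pi.smul_apply, smul_eq_mul,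
      (Hc.isUnitNormal q'.1 hq'.1).val_self]
    ring
  -- the scaling function `|∂_t F|⁻¹ = H`
  have hval := contMDiffAt_val_apply_along (ofRiemannian h) le_rfl hW hW
  have hpos : 0 < (ofRiemannian h).val (F q.1 ((extChartAt (𝓡 2) y₀).symm q.2))
      (mfderiv 𝓘(ℝ, ℝ × EuclideanSpace ℝ (Fin 2)) (𝓡 3)
        (fun q : ℝ × EuclideanSpace ℝ (Fin 2) ↦ F q.1 ((extChartAt (𝓡 2) y₀).symm q.2)) q
        ((1 : ℝ), (0 : EuclideanSpace ℝ (Fin 2))))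
      (mfderiv 𝓘(ℝ, ℝ × EuclideanSpace ℝ (Fin 2)) (𝓡 3)
        (fun q : ℝ × EuclideanSpace ℝ (Fin 2) ↦ F q.1 ((extChartAt (𝓡 2) y₀).symm q.2)) q
        ((1 : ℝ), (0 : EuclideanSpace ℝ (Fin 2)))) := by
    rw [hWW q hq]
    exact pow_pos (inv_pos.2 (Hc.meanCurvature_pos _ hq.1 _)) 2
  have hc : ContMDiffAt 𝓘(ℝ, ℝ × EuclideanSpace ℝ (Fin 2)) 𝓘(ℝ, ℝ) ∞ (fun q' ↦ (Real.sqrt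
      ((ofRiemannian h).val (F q'.1 ((extChartAt (𝓡 2) y₀).symm q'.2))
        (mfderiv 𝓘(ℝ, ℝ × EuclideanSpace ℝ (Fin 2)) (𝓡 3)
          (fun q : ℝ × EuclideanSpace ℝ (Fin 2) ↦ F q.1 ((extChartAt (𝓡 2) y₀).symm q.2)) q'
          ((1 : ℝ), (0 : EuclideanSpace ℝ (Fin 2))))
        (mfderiv 𝓘(ℝ, ℝ × EuclideanSpace ℝ (Fin 2)) (𝓡 3)
          (fun q : ℝ × EuclideanSpace ℝ (Fin 2) ↦ F q.1 ((extChartAt (𝓡 2) y₀).symm q.2)) q'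
          ((1 : ℝ), (0 : EuclideanSpace ℝ (Fin 2))))))⁻¹) q := by
    have h1 := contMDiffAt_iff_contDiffAt.1 hval
    have h2 := (h1.sqrt hpos.ne').inv (Real.sqrt_pos.2 hpos).ne'
    exact contMDiffAt_iff_contDiffAt.2 h2
  refine (contMDiffAt_lift_smul hW hc).congr_of_eventuallyEq ?_
  filter_upwards [hD.mem_nhds hq] with q' hq'
  have hHpos := Hc.meanCurvature_pos _ hq'.1 ((extChartAt (𝓡 2) y₀).symm q'.2)
  rw [hWW q' hq', Real.sqrt_sq (inv_pos.2 hHpos).le, inv_inv, hvel q' hq', smul_smul,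
    mul_inv_cancel₀ hHpos.ne', one_smul]

/-- The lifts `q ↦ (P q, dP_q(0, e_c))` of the chart flow map are smooth on `(a, b) × φ.target`.
[folklore] -/
theorem contMDiffAt_lift_mfderiv_chartFlow (Hc : IsClassicalIMCF h hpb F ν a b)
    {q : ℝ × EuclideanSpace ℝ (Fin 2)} (hq : q ∈ Set.Ioo a b ×ˢ (extChartAt (𝓡 2) y₀).target)
    (v₀ : ℝ × EuclideanSpace ℝ (Fin 2)) :
    ContMDiffAt 𝓘(ℝ, ℝ × EuclideanSpace ℝ (Fin 2)) (𝓡 3).tangent ∞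
      (fun q' : ℝ × EuclideanSpace ℝ (Fin 2) ↦ (TotalSpace.mk' E3
        (F q'.1 ((extChartAt (𝓡 2) y₀).symm q'.2))
        (mfderiv 𝓘(ℝ, ℝ × EuclideanSpace ℝ (Fin 2)) (𝓡 3)
          (fun q : ℝ × EuclideanSpace ℝ (Fin 2) ↦ F q.1 ((extChartAt (𝓡 2) y₀).symm q.2)) q' v₀) :
          TangentBundle (𝓡 3) X)) q :=
  contMDiffAt_lift_mfderiv_const (isOpen_Ioo.prod (isOpen_extChartAt_target y₀))
    Hc.contMDiffOn_chartFlow hq v₀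

/-- **The coefficients of the unit normal in an ambient frame are jointly smooth**, through the
chart flow map: for the trivialisation `e` of `TX` at `x₁` and a point `q` with
`F q.1 (φ⁻¹ q.2)` in the chart domain of `x₁`, `q' ↦ eⁱ(ν_{q'.1}(φ⁻¹ q'.2))` is `C^∞` at `q`.
[folklore] -/
theorem contMDiffAt_normal_coeff_chartFlow (Hc : IsClassicalIMCF h hpb F ν a b) {ι : Type*}
    (bE : Module.Basis ι ℝ E3) {x₁ : X}
    {q : ℝ × EuclideanSpace ℝ (Fin 2)} (hq : q ∈ Set.Ioo a b ×ˢ (extChartAt (𝓡 2) y₀).target)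
    (hx : F q.1 ((extChartAt (𝓡 2) y₀).symm q.2) ∈ (chartAt E3 x₁).source) (i : ι) :
    ContMDiffAt 𝓘(ℝ, ℝ × EuclideanSpace ℝ (Fin 2)) 𝓘(ℝ, ℝ) ∞
      (fun q' : ℝ × EuclideanSpace ℝ (Fin 2) ↦
        (trivializationAt E3 (TangentSpace (𝓡 3) : X → Type _) x₁).localFrame_coeff (𝓡 3) bE i
          (F q'.1 ((extChartAt (𝓡 2) y₀).symm q'.2)) (ν q'.1 ((extChartAt (𝓡 2) y₀).symm q'.2))) q
              := by
  have hI1 : IsManifold (𝓡 3) (∞ + 1) X := inferInstanceAs (IsManifold (𝓡 3) ∞ X)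
  have hVB : ContMDiffVectorBundle ∞ E3 (TangentSpace (𝓡 3) : X → Type _) (𝓡 3) :=
    TangentBundle.contMDiffVectorBundle
  set e := trivializationAt E3 (TangentSpace (𝓡 3) : X → Type _) x₁ with he
  have hbase : e.baseSet = (chartAt E3 x₁).source := by simp [he]
  have hν := Hc.contMDiffAt_lift_normal_chartFlow (y₀ := y₀) hq
  have hsrc : (TotalSpace.mk' E3 (F q.1 ((extChartAt (𝓡 2) y₀).symm q.2))
      (ν q.1 ((extChartAt (𝓡 2) y₀).symm q.2)) : TangentBundle (𝓡 3) X) ∈ e.source := by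
    rw [e.mem_source, hbase]; exact hx
  have hνc := ((e.contMDiffAt_iff (f := fun q' : ℝ × EuclideanSpace ℝ (Fin 2) ↦
      (TotalSpace.mk' E3 (F q'.1 ((extChartAt (𝓡 2) y₀).symm q'.2))
        (ν q'.1 ((extChartAt (𝓡 2) y₀).symm q'.2)) : TangentBundle (𝓡 3) X)) hsrc).1 hν).2
  have hcont : ContinuousAt (fun q' : ℝ × EuclideanSpace ℝ (Fin 2) ↦
      F q'.1 ((extChartAt (𝓡 2) y₀).symm q'.2)) q :=
    ((e.contMDiffAt_iff (f := fun q' : ℝ × EuclideanSpace ℝ (Fin 2) ↦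
      (TotalSpace.mk' E3 (F q'.1 ((extChartAt (𝓡 2) y₀).symm q'.2))
        (ν q'.1 ((extChartAt (𝓡 2) y₀).symm q'.2)) : TangentBundle (𝓡 3) X)) hsrc).1
          hν).1.continuousAt
  have hnear : ∀ᶠ q' : ℝ × EuclideanSpace ℝ (Fin 2) in 𝓝 q,
      F q'.1 ((extChartAt (𝓡 2) y₀).symm q'.2) ∈ (chartAt E3 x₁).source :=
    hcont.preimage_mem_nhds ((chartAt E3 x₁).open_source.mem_nhds hx)
  have h1 : ContMDiffAt 𝓘(ℝ, ℝ × EuclideanSpace ℝ (Fin 2)) 𝓘(ℝ, ℝ) ∞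
      (fun q' ↦ bE.coord i (e (TotalSpace.mk' E3 (F q'.1 ((extChartAt (𝓡 2) y₀).symm q'.2))
        (ν q'.1 ((extChartAt (𝓡 2) y₀).symm q'.2)) : TangentBundle (𝓡 3) X)).2) q :=
    (LinearMap.toContinuousLinearMap (bE.coord i)).contMDiff.contMDiffAt.comp q hνc
  refine h1.congr_of_eventuallyEq ?_
  filter_upwards [hnear] with q' hq'
  have hxe : F q'.1 ((extChartAt (𝓡 2) y₀).symm q'.2) ∈ e.baseSet := by rwa [hbase]
  rw [e.localFrame_coeff_eq_coeff (b := bE) (s := fun _ ↦ ν q'.1 ((extChartAt (𝓡 2) y₀).symm q'.2))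
    hxe]
  simp

/-- **The second fundamental form is jointly smooth along a classical solution**, read in fixed
frames: for the coordinate frame `∂ₐ` of the chart `φ` of `S` at `y₀`,
`(t, u) ↦ K_{ν_t}(∂ₐ, ∂_c)(φ⁻¹ u)` is `C^∞` on `(a, b) × φ.target`. In the frame `sᵢ` of `TX` at
`x₁ = F t (φ⁻¹ u)`, `K(∂ₐ, ∂_c) = ∑ᵢ (∂ₐ νⁱ) h(sᵢ, dF ∂_c) + ∑ᵢ νⁱ h(∇_{dF ∂ₐ} sᵢ, dF ∂_c)`
(`secondFundamentalForm_apply_eq_frame`), with `dF_t ∂_c = dP(0, e_c)` and `∂ₐ νⁱ` the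
`u`-derivative of the jointly smooth coefficient `νⁱ(t, u)`; all factors are smooth in `(t, u)`
(`contMDiffAt_normal_coeff_chartFlow`, `contMDiffAt_lift_mfderiv_chartFlow`, smooth Christoffel data
`exists_contMDiffOn_christoffel`). O'Neill 1983, Ch. 4, Lemma 4 (smoothness of the shape tensor).
[cite: ONeill1983, Ch. 4, Lemma 4] -/
theorem contMDiffAt_secondFundamentalForm_chartFlow (Hc : IsClassicalIMCF h hpb F ν a b)
    {ι : Type*} [Fintype ι] (b₂ : Module.Basis ι ℝ (EuclideanSpace ℝ (Fin 2)))
    {q : ℝ × EuclideanSpace ℝ (Fin 2)} (hq : q ∈ Set.Ioo a b ×ˢ (extChartAt (𝓡 2) y₀).target)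
    (a' c : ι) :
    ContMDiffAt 𝓘(ℝ, ℝ × EuclideanSpace ℝ (Fin 2)) 𝓘(ℝ, ℝ) ∞
      (fun q' : ℝ × EuclideanSpace ℝ (Fin 2) ↦
        (ofRiemannian h).secondFundamentalForm (𝓡 2) (F q'.1) (ν q'.1)
          ((extChartAt (𝓡 2) y₀).symm q'.2)
          ((trivializationAt (EuclideanSpace ℝ (Fin 2)) (TangentSpace (𝓡 2)) y₀).localFrame b₂ a'
            ((extChartAt (𝓡 2) y₀).symm q'.2))
          ((trivializationAt (EuclideanSpace ℝ (Fin 2)) (TangentSpace (𝓡 2)) y₀).localFrame b₂ c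
            ((extChartAt (𝓡 2) y₀).symm q'.2))) q := by
  classical
  have hI1 : IsManifold (𝓡 3) (∞ + 1) X := inferInstanceAs (IsManifold (𝓡 3) ∞ X)
  have hVB : ContMDiffVectorBundle ∞ E3 (TangentSpace (𝓡 3) : X → Type _) (𝓡 3) :=
    TangentBundle.contMDiffVectorBundle
  set g := ofRiemannian h with hg
  have hD : IsOpen (Set.Ioo a b ×ˢ (extChartAt (𝓡 2) y₀).target) :=
    isOpen_Ioo.prod (isOpen_extChartAt_target y₀)
  have hP := Hc.contMDiffOn_chartFlow (y₀ := y₀)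
  set x₁ : X := F q.1 ((extChartAt (𝓡 2) y₀).symm q.2) with hx₁
  set e := trivializationAt E3 (TangentSpace (𝓡 3) : X → Type _) x₁ with he
  set bE := Module.finBasis ℝ E3 with hbE
  have hbase : e.baseSet = (chartAt E3 x₁).source := by simp [he]
  have hx : F q.1 ((extChartAt (𝓡 2) y₀).symm q.2) ∈ (chartAt E3 x₁).source :=
    mem_chart_source E3 x₁
  -- points near `q`
  have hnear : ∀ᶠ q' : ℝ × EuclideanSpace ℝ (Fin 2) in 𝓝 q,
      q' ∈ Set.Ioo a b ×ˢ (extChartAt (𝓡 2) y₀).target ∧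
      F q'.1 ((extChartAt (𝓡 2) y₀).symm q'.2) ∈ (chartAt E3 x₁).source := by
    exact Filter.Eventually.and (hD.mem_nhds hq)
      ((hP.contMDiffAt (hD.mem_nhds hq)).continuousAt.preimage_mem_nhds
        ((chartAt E3 x₁).open_source.mem_nhds hx))
  have hPq : ContMDiffAt 𝓘(ℝ, ℝ × EuclideanSpace ℝ (Fin 2)) (𝓡 3) ∞
      (fun q : ℝ × EuclideanSpace ℝ (Fin 2) ↦ F q.1 ((extChartAt (𝓡 2) y₀).symm q.2)) q :=
    hP.contMDiffAt (hD.mem_nhds hq)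
  -- (i) the coefficient functions `νⁱ(t, u)`: smooth on the open set `D'` around `q`
  set D' : Set (ℝ × EuclideanSpace ℝ (Fin 2)) := {q' | q' ∈ Set.Ioo a b ×ˢ
    (extChartAt (𝓡 2) y₀).target ∧ F q'.1 ((extChartAt (𝓡 2) y₀).symm q'.2) ∈
      (chartAt E3 x₁).source} with hD'
  have hD'o : IsOpen D' :=
    hP.continuousOn.isOpen_inter_preimage hD (chartAt E3 x₁).open_source
  have hqD' : q ∈ D' := ⟨hq, hx⟩
  have hcoefOn : ∀ i, ContDiffOn ℝ ∞ (fun q' : ℝ × EuclideanSpace ℝ (Fin 2) ↦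
      e.localFrame_coeff (𝓡 3) bE i (F q'.1 ((extChartAt (𝓡 2) y₀).symm q'.2))
        (ν q'.1 ((extChartAt (𝓡 2) y₀).symm q'.2))) D' := fun i ↦ by
    rw [← contMDiffOn_iff_contDiffOn]
    exact fun q' hq' ↦ (Hc.contMDiffAt_normal_coeff_chartFlow bE hq'.1 hq'.2 i).contMDiffWithinAt
  have hcoef : ∀ i, ContMDiffAt 𝓘(ℝ, ℝ × EuclideanSpace ℝ (Fin 2)) 𝓘(ℝ, ℝ) ∞
      (fun q' : ℝ × EuclideanSpace ℝ (Fin 2) ↦ e.localFrame_coeff (𝓡 3) bE i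
        (F q'.1 ((extChartAt (𝓡 2) y₀).symm q'.2)) (ν q'.1 ((extChartAt (𝓡 2) y₀).symm q'.2))) q :=
    fun i ↦ Hc.contMDiffAt_normal_coeff_chartFlow bE hq hx i
  -- (ii) their `u`-derivatives along `∂ₐ`, as functions of `(t, u)`
  have hdcoef : ∀ i, ContMDiffAt 𝓘(ℝ, ℝ × EuclideanSpace ℝ (Fin 2)) 𝓘(ℝ, ℝ) ∞
      (fun q' : ℝ × EuclideanSpace ℝ (Fin 2) ↦ fderiv ℝ (fun q'' : ℝ × EuclideanSpace ℝ (Fin 2) ↦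
        e.localFrame_coeff (𝓡 3) bE i (F q''.1 ((extChartAt (𝓡 2) y₀).symm q''.2))
          (ν q''.1 ((extChartAt (𝓡 2) y₀).symm q''.2))) q' ((0 : ℝ), b₂ a')) q := fun i ↦
    (contMDiffOn_iff_contDiffOn.2 (((hcoefOn i).fderiv_of_isOpen hD'o le_rfl).clm_apply
      contDiffOn_const)).contMDiffAt (hD'o.mem_nhds hqD')
  -- identification of `∂ₐ νⁱ` with that `u`-derivative, near `q`
  have hT1 : ∀ i, ∀ q' ∈ D', (show ℝ from mfderiv (𝓡 2) 𝓘(ℝ, ℝ)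
      (fun x ↦ e.localFrame_coeff (𝓡 3) bE i (F q'.1 x) (ν q'.1 x))
      ((extChartAt (𝓡 2) y₀).symm q'.2)
      ((trivializationAt (EuclideanSpace ℝ (Fin 2)) (TangentSpace (𝓡 2)) y₀).localFrame b₂ a'
        ((extChartAt (𝓡 2) y₀).symm q'.2))) =
      fderiv ℝ (fun q'' : ℝ × EuclideanSpace ℝ (Fin 2) ↦
        e.localFrame_coeff (𝓡 3) bE i (F q''.1 ((extChartAt (𝓡 2) y₀).symm q''.2))
          (ν q''.1 ((extChartAt (𝓡 2) y₀).symm q''.2))) q' ((0 : ℝ), b₂ a') := by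
    rintro i ⟨t, u⟩ hq'
    have hu : u ∈ (extChartAt (𝓡 2) y₀).target := hq'.1.2
    have hsrc : (extChartAt (𝓡 2) y₀).symm u ∈ (chartAt (EuclideanSpace ℝ (Fin 2)) y₀).source := by
      rw [← extChartAt_source (𝓡 2)]; exact (extChartAt (𝓡 2) y₀).map_target hu
    -- the coefficient near `φ⁻¹ u` is the chart function composed with `φ`
    have hN : DifferentiableAt ℝ (fun q'' : ℝ × EuclideanSpace ℝ (Fin 2) ↦
        e.localFrame_coeff (𝓡 3) bE i (F q''.1 ((extChartAt (𝓡 2) y₀).symm q''.2))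
          (ν q''.1 ((extChartAt (𝓡 2) y₀).symm q''.2))) (t, u) :=
      ((hcoefOn i).differentiableOn (by simp) _ hq').differentiableAt (hD'o.mem_nhds hq')
    have hι : HasFDerivAt (fun u' : EuclideanSpace ℝ (Fin 2) ↦ ((t, u') : ℝ × EuclideanSpace ℝ (Fin
        2)))
        (ContinuousLinearMap.inr ℝ ℝ (EuclideanSpace ℝ (Fin 2))) u :=
      ((ContinuousLinearMap.inr ℝ ℝ (EuclideanSpace ℝ (Fin 2))).hasFDerivAt.add_const
        ((t, (0 : EuclideanSpace ℝ (Fin 2))) : ℝ × EuclideanSpace ℝ (Fin 2))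
        |>.congr_of_eventuallyEq (Eventually.of_forall fun s ↦ by simp))
    have hNt : HasFDerivAt (fun u' : EuclideanSpace ℝ (Fin 2) ↦
        e.localFrame_coeff (𝓡 3) bE i (F t ((extChartAt (𝓡 2) y₀).symm u'))
          (ν t ((extChartAt (𝓡 2) y₀).symm u')))
        ((fderiv ℝ (fun q'' : ℝ × EuclideanSpace ℝ (Fin 2) ↦
          e.localFrame_coeff (𝓡 3) bE i (F q''.1 ((extChartAt (𝓡 2) y₀).symm q''.2))
            (ν q''.1 ((extChartAt (𝓡 2) y₀).symm q''.2))) (t, u)).comp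
          (ContinuousLinearMap.inr ℝ ℝ (EuclideanSpace ℝ (Fin 2)))) u :=
      hN.hasFDerivAt.comp u hι
    -- the spatial coefficient function on `S` agrees with it through the chart, near `φ⁻¹ u`
    have hφd : MDifferentiableAt (𝓡 2) 𝓘(ℝ, EuclideanSpace ℝ (Fin 2)) (extChartAt (𝓡 2) y₀)
        ((extChartAt (𝓡 2) y₀).symm u) := mdifferentiableAt_extChartAt hsrc
    have hev : (fun x ↦ e.localFrame_coeff (𝓡 3) bE i (F t x) (ν t x)) =ᶠ[𝓝 ((extChartAt (𝓡 2)
        y₀).symm u)]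
        (fun u' : EuclideanSpace ℝ (Fin 2) ↦
          e.localFrame_coeff (𝓡 3) bE i (F t ((extChartAt (𝓡 2) y₀).symm u'))
            (ν t ((extChartAt (𝓡 2) y₀).symm u'))) ∘ extChartAt (𝓡 2) y₀ := by
      filter_upwards [(chartAt (EuclideanSpace ℝ (Fin 2)) y₀).open_source.mem_nhds hsrc] with x hx
      rw [← extChartAt_source (𝓡 2)] at hx
      show _ = e.localFrame_coeff (𝓡 3) bE i (F t ((extChartAt (𝓡 2) y₀).symm
        (extChartAt (𝓡 2) y₀ x))) (ν t ((extChartAt (𝓡 2) y₀).symm (extChartAt (𝓡 2) y₀ x)))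
      rw [(extChartAt (𝓡 2) y₀).left_inv hx]
    have hNt' : MDifferentiableAt 𝓘(ℝ, EuclideanSpace ℝ (Fin 2)) 𝓘(ℝ, ℝ)
        (fun u' : EuclideanSpace ℝ (Fin 2) ↦
          e.localFrame_coeff (𝓡 3) bE i (F t ((extChartAt (𝓡 2) y₀).symm u'))
            (ν t ((extChartAt (𝓡 2) y₀).symm u')))
        (extChartAt (𝓡 2) y₀ ((extChartAt (𝓡 2) y₀).symm u)) := by
      rw [(extChartAt (𝓡 2) y₀).right_inv hu]
      exact hNt.differentiableAt.mdifferentiableAt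
    have e1 := DFunLike.congr_fun (hev.mfderiv_eq (I := 𝓡 2) (I' := 𝓘(ℝ, ℝ)))
      ((trivializationAt (EuclideanSpace ℝ (Fin 2)) (TangentSpace (𝓡 2)) y₀).localFrame b₂ a'
        ((extChartAt (𝓡 2) y₀).symm u))
    have e2 := mfderiv_comp_apply ((extChartAt (𝓡 2) y₀).symm u) hNt' hφd
      ((trivializationAt (EuclideanSpace ℝ (Fin 2)) (TangentSpace (𝓡 2)) y₀).localFrame b₂ a'
        ((extChartAt (𝓡 2) y₀).symm u))
    have e3 : mfderiv (𝓡 2) 𝓘(ℝ, EuclideanSpace ℝ (Fin 2)) (extChartAt (𝓡 2) y₀)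
        ((extChartAt (𝓡 2) y₀).symm u)
        ((trivializationAt (EuclideanSpace ℝ (Fin 2)) (TangentSpace (𝓡 2)) y₀).localFrame b₂ a'
          ((extChartAt (𝓡 2) y₀).symm u)) = b₂ a' := by
      have h3 := continuousLinearMapAt_localFrame (I := 𝓡 2) b₂ hsrc a'
      rw [TangentBundle.continuousLinearMapAt_trivializationAt hsrc] at h3
      exact h3
    have e4 : mfderiv 𝓘(ℝ, EuclideanSpace ℝ (Fin 2)) 𝓘(ℝ, ℝ)
        (fun u' : EuclideanSpace ℝ (Fin 2) ↦
          e.localFrame_coeff (𝓡 3) bE i (F t ((extChartAt (𝓡 2) y₀).symm u'))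
            (ν t ((extChartAt (𝓡 2) y₀).symm u')))
        (extChartAt (𝓡 2) y₀ ((extChartAt (𝓡 2) y₀).symm u)) (b₂ a') =
        fderiv ℝ (fun q'' : ℝ × EuclideanSpace ℝ (Fin 2) ↦
          e.localFrame_coeff (𝓡 3) bE i (F q''.1 ((extChartAt (𝓡 2) y₀).symm q''.2))
            (ν q''.1 ((extChartAt (𝓡 2) y₀).symm q''.2))) (t, u) ((0 : ℝ), b₂ a') := by
      rw [(extChartAt (𝓡 2) y₀).right_inv hu, mfderiv_eq_fderiv, hNt.fderiv]
      rfl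
    exact e1.trans (e2.trans ((congrArg _ e3).trans e4))
  -- (iii) the fields `sᵢ ∘ P`, `dP(0, e_a)`, `dP(0, e_c)` along `P`
  have hsf : ∀ i, ContMDiffAt 𝓘(ℝ, ℝ × EuclideanSpace ℝ (Fin 2)) (𝓡 3).tangent ∞
      (fun q' : ℝ × EuclideanSpace ℝ (Fin 2) ↦ (TotalSpace.mk' E3
        (F q'.1 ((extChartAt (𝓡 2) y₀).symm q'.2))
        (e.localFrame bE i (F q'.1 ((extChartAt (𝓡 2) y₀).symm q'.2))) : TangentBundle (𝓡 3) X))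
      q := fun i ↦
    (contMDiffAt_localFrame_of_mem ∞ e bE i (by rw [hbase]; exact hx)).comp q hPq
  have hVa := Hc.contMDiffAt_lift_mfderiv_chartFlow (y₀ := y₀) hq ((0 : ℝ), b₂ a')
  have hVc := Hc.contMDiffAt_lift_mfderiv_chartFlow (y₀ := y₀) hq ((0 : ℝ), b₂ c)
  -- (iv) the fields `∇_{dP(0,e_a)} sᵢ` along `P`, via smooth Christoffel data
  obtain ⟨C, hC, hCs⟩ := exists_contMDiffOn_christoffel (cov := g.leviCivita)
    (g.isLocallyContMDiff_leviCivita_holds ⊤ (by exact_mod_cast le_top)) bE x₁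
  have hcov : ∀ i, ContMDiffAt 𝓘(ℝ, ℝ × EuclideanSpace ℝ (Fin 2)) (𝓡 3).tangent ∞
      (fun q' : ℝ × EuclideanSpace ℝ (Fin 2) ↦ (TotalSpace.mk' E3
        (F q'.1 ((extChartAt (𝓡 2) y₀).symm q'.2))
        (g.leviCivita (e.localFrame bE i) (F q'.1 ((extChartAt (𝓡 2) y₀).symm q'.2))
          (mfderiv 𝓘(ℝ, ℝ × EuclideanSpace ℝ (Fin 2)) (𝓡 3)
            (fun q : ℝ × EuclideanSpace ℝ (Fin 2) ↦ F q.1 ((extChartAt (𝓡 2) y₀).symm q.2)) q'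
            ((0 : ℝ), b₂ a'))) : TangentBundle (𝓡 3) X)) q := by
    intro i
    have hsrc' : ∀ w : TangentSpace (𝓡 3) (F q.1 ((extChartAt (𝓡 2) y₀).symm q.2)),
        (TotalSpace.mk' E3 (F q.1 ((extChartAt (𝓡 2) y₀).symm q.2)) w : TangentBundle (𝓡 3) X) ∈
          e.source := fun w ↦ by rw [e.mem_source, hbase]; exact hx
    refine (e.contMDiffAt_iff (f := fun q' : ℝ × EuclideanSpace ℝ (Fin 2) ↦ (TotalSpace.mk' E3
        (F q'.1 ((extChartAt (𝓡 2) y₀).symm q'.2))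
        (g.leviCivita (e.localFrame bE i) (F q'.1 ((extChartAt (𝓡 2) y₀).symm q'.2))
          (mfderiv 𝓘(ℝ, ℝ × EuclideanSpace ℝ (Fin 2)) (𝓡 3)
            (fun q : ℝ × EuclideanSpace ℝ (Fin 2) ↦ F q.1 ((extChartAt (𝓡 2) y₀).symm q.2)) q'
            ((0 : ℝ), b₂ a'))) : TangentBundle (𝓡 3) X)) (hsrc' _)).2 ⟨hPq, ?_⟩
    have hdfV := ((e.contMDiffAt_iff (f := fun q' : ℝ × EuclideanSpace ℝ (Fin 2) ↦
      (TotalSpace.mk' E3 (F q'.1 ((extChartAt (𝓡 2) y₀).symm q'.2))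
        (mfderiv 𝓘(ℝ, ℝ × EuclideanSpace ℝ (Fin 2)) (𝓡 3)
          (fun q : ℝ × EuclideanSpace ℝ (Fin 2) ↦ F q.1 ((extChartAt (𝓡 2) y₀).symm q.2)) q'
          ((0 : ℝ), b₂ a')) : TangentBundle (𝓡 3) X)) (hsrc' _)).1 hVa).2
    have hCf : ContMDiffAt 𝓘(ℝ, ℝ × EuclideanSpace ℝ (Fin 2)) 𝓘(ℝ, E3 →L[ℝ] E3) ∞
        (fun q' : ℝ × EuclideanSpace ℝ (Fin 2) ↦ C i (F q'.1 ((extChartAt (𝓡 2) y₀).symm q'.2))) q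
            :=
      ((hCs i).contMDiffAt ((chartAt E3 x₁).open_source.mem_nhds hx)).comp q hPq
    refine (hCf.clm_apply hdfV).congr_of_eventuallyEq ?_
    filter_upwards [hnear] with q' hq'
    have hye : F q'.1 ((extChartAt (𝓡 2) y₀).symm q'.2) ∈ e.baseSet := by rw [hbase]; exact hq'.2
    rw [← hC _ hq'.2 i, Trivialization.continuousLinearMapAt_apply_of_mem ℝ _ hye]
  -- the formula near `q`
  have hformula : (fun q' : ℝ × EuclideanSpace ℝ (Fin 2) ↦
      g.secondFundamentalForm (𝓡 2) (F q'.1) (ν q'.1) ((extChartAt (𝓡 2) y₀).symm q'.2)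
        ((trivializationAt (EuclideanSpace ℝ (Fin 2)) (TangentSpace (𝓡 2)) y₀).localFrame b₂ a'
          ((extChartAt (𝓡 2) y₀).symm q'.2))
        ((trivializationAt (EuclideanSpace ℝ (Fin 2)) (TangentSpace (𝓡 2)) y₀).localFrame b₂ c
          ((extChartAt (𝓡 2) y₀).symm q'.2))) =ᶠ[𝓝 q]
      fun q' ↦ ∑ i, fderiv ℝ (fun q'' : ℝ × EuclideanSpace ℝ (Fin 2) ↦
          e.localFrame_coeff (𝓡 3) bE i (F q''.1 ((extChartAt (𝓡 2) y₀).symm q''.2))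
            (ν q''.1 ((extChartAt (𝓡 2) y₀).symm q''.2))) q' ((0 : ℝ), b₂ a') *
          g.val (F q'.1 ((extChartAt (𝓡 2) y₀).symm q'.2))
            (e.localFrame bE i (F q'.1 ((extChartAt (𝓡 2) y₀).symm q'.2)))
            (mfderiv 𝓘(ℝ, ℝ × EuclideanSpace ℝ (Fin 2)) (𝓡 3)
              (fun q : ℝ × EuclideanSpace ℝ (Fin 2) ↦ F q.1 ((extChartAt (𝓡 2) y₀).symm q.2)) q'
              ((0 : ℝ), b₂ c)) +
        ∑ i, e.localFrame_coeff (𝓡 3) bE i (F q'.1 ((extChartAt (𝓡 2) y₀).symm q'.2))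
            (ν q'.1 ((extChartAt (𝓡 2) y₀).symm q'.2)) *
          g.val (F q'.1 ((extChartAt (𝓡 2) y₀).symm q'.2))
            (g.leviCivita (e.localFrame bE i) (F q'.1 ((extChartAt (𝓡 2) y₀).symm q'.2))
              (mfderiv 𝓘(ℝ, ℝ × EuclideanSpace ℝ (Fin 2)) (𝓡 3)
                (fun q : ℝ × EuclideanSpace ℝ (Fin 2) ↦ F q.1 ((extChartAt (𝓡 2) y₀).symm q.2)) q'
                ((0 : ℝ), b₂ a')))
            (mfderiv 𝓘(ℝ, ℝ × EuclideanSpace ℝ (Fin 2)) (𝓡 3)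
              (fun q : ℝ × EuclideanSpace ℝ (Fin 2) ↦ F q.1 ((extChartAt (𝓡 2) y₀).symm q.2)) q'
              ((0 : ℝ), b₂ c)) := by
    filter_upwards [hnear] with q' hq'
    obtain ⟨t, u⟩ := q'
    have ht : t ∈ Set.Ioo a b := hq'.1.1
    have hu : u ∈ (extChartAt (𝓡 2) y₀).target := hq'.1.2
    have hνt : MDifferentiableAt (𝓡 2) (𝓡 3).tangent (fun x ↦ (TotalSpace.mk' E3 (F t x) (ν t x) :
        TangentBundle (𝓡 3) X)) ((extChartAt (𝓡 2) y₀).symm u) :=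
      ((Hc.contMDiff_normal t ht) _).mdifferentiableAt (by simp)
    have hFt : MDifferentiableAt (𝓡 2) (𝓡 3) (F t) ((extChartAt (𝓡 2) y₀).symm u) :=
      Hc.mdifferentiableAt_slice ht _
    have hPd : MDifferentiableAt 𝓘(ℝ, ℝ × EuclideanSpace ℝ (Fin 2)) (𝓡 3)
        (fun q : ℝ × EuclideanSpace ℝ (Fin 2) ↦ F q.1 ((extChartAt (𝓡 2) y₀).symm q.2)) (t, u) :=
      (hP.contMDiffAt (hD.mem_nhds hq'.1)).mdifferentiableAt (by simp)
    dsimp only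
    rw [g.secondFundamentalForm_apply_eq_frame bE hq'.2 hνt, ←
        mfderiv_localFrame_eq_mfderiv_chartFlow
      b₂ hu hFt hPd a', ← mfderiv_localFrame_eq_mfderiv_chartFlow b₂ hu hFt hPd c]
    refine congrArg₂ (· + ·) (Finset.sum_congr rfl fun i _ ↦ ?_) rfl
    rw [hT1 i (t, u) hq']
  refine ContMDiffAt.congr_of_eventuallyEq ?_ hformula
  refine (ContMDiffAt.sum fun i _ ↦ ?_).add (ContMDiffAt.sum fun i _ ↦ ?_)
  · exact (hdcoef i).mul (contMDiffAt_val_apply_along g le_rfl (hsf i) hVc)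
  · exact (hcoef i).mul (contMDiffAt_val_apply_along g le_rfl (hcov i) hVc)

/-- **The induced metric coefficients are jointly smooth along a classical solution**:
`(t, u) ↦ h(dF_t ∂ₐ, dF_t ∂_c)(φ⁻¹ u) = h(dP(0,eₐ), dP(0,e_c))` is `C^∞` on `(a, b) × φ.target`.
[folklore] -/
theorem contMDiffAt_gram_chartFlow (Hc : IsClassicalIMCF h hpb F ν a b)
    {ι : Type*} (b₂ : Module.Basis ι ℝ (EuclideanSpace ℝ (Fin 2)))
    {q : ℝ × EuclideanSpace ℝ (Fin 2)} (hq : q ∈ Set.Ioo a b ×ˢ (extChartAt (𝓡 2) y₀).target)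
    (a' c : ι) :
    ContMDiffAt 𝓘(ℝ, ℝ × EuclideanSpace ℝ (Fin 2)) 𝓘(ℝ, ℝ) ∞
      (fun q' : ℝ × EuclideanSpace ℝ (Fin 2) ↦ (ofRiemannian h).val
        (F q'.1 ((extChartAt (𝓡 2) y₀).symm q'.2))
        (mfderiv 𝓘(ℝ, ℝ × EuclideanSpace ℝ (Fin 2)) (𝓡 3)
          (fun q : ℝ × EuclideanSpace ℝ (Fin 2) ↦ F q.1 ((extChartAt (𝓡 2) y₀).symm q.2)) q'
          ((0 : ℝ), b₂ a'))
        (mfderiv 𝓘(ℝ, ℝ × EuclideanSpace ℝ (Fin 2)) (𝓡 3)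
          (fun q : ℝ × EuclideanSpace ℝ (Fin 2) ↦ F q.1 ((extChartAt (𝓡 2) y₀).symm q.2)) q'
          ((0 : ℝ), b₂ c))) q :=
  contMDiffAt_val_apply_along (ofRiemannian h) le_rfl
    (Hc.contMDiffAt_lift_mfderiv_chartFlow hq _) (Hc.contMDiffAt_lift_mfderiv_chartFlow hq _)

/-- **The mean curvature of a classical solution is jointly smooth in `(t, y)`**: for any
representative `Hf : ℝ → S → ℝ` of the mean curvature on `(a, b)` and any chart `φ` of `S`,
`(t, u) ↦ Hf t (φ⁻¹ u)` is `C^∞` on `(a, b) × φ.target`. In the coordinate frame of `φ`,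
`H = ∑_{ac} (𝒢⁻¹)_{ca} K(∂ₐ, ∂_c)` (`trace_eq_sum_gram_inv`) with `𝒢` and `K` jointly smooth
(`contMDiffAt_gram_chartFlow`, `contMDiffAt_secondFundamentalForm_chartFlow`) and `det 𝒢 ≠ 0`
(`contMDiffAt_matrix_inv`). This is the joint regularity of `H` used to differentiate
`∫_{N_t} H² dμ_t` under the integral sign (Huisken–Ilmanen 2001, §5, Monotonicity Calculation,
line 1; "smooth family", §0 (∗)). [cite: HuiskenIlmanenIMCF2001, §0 (∗)] -/
theorem contMDiffAt_meanCurvature_chartFlow (Hc : IsClassicalIMCF h hpb F ν a b) (Hf : ℝ → S → ℝ)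
    (hHf : ∀ t (ht : t ∈ Set.Ioo a b) (y : S), Hf t y =
      (ofRiemannian h).meanCurvature (F t) hpb (Hc.isSpacelikeImmersion t ht) (ν t) y)
    {q : ℝ × EuclideanSpace ℝ (Fin 2)} (hq : q ∈ Set.Ioo a b ×ˢ (extChartAt (𝓡 2) y₀).target) :
    ContMDiffAt 𝓘(ℝ, ℝ × EuclideanSpace ℝ (Fin 2)) 𝓘(ℝ, ℝ) ∞
      (fun q' : ℝ × EuclideanSpace ℝ (Fin 2) ↦ Hf q'.1 ((extChartAt (𝓡 2) y₀).symm q'.2)) q := by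
  classical
  set b₂ := Module.finBasis ℝ (EuclideanSpace ℝ (Fin 2)) with hb₂
  have hD : IsOpen (Set.Ioo a b ×ˢ (extChartAt (𝓡 2) y₀).target) :=
    isOpen_Ioo.prod (isOpen_extChartAt_target y₀)
  have hP := Hc.contMDiffOn_chartFlow (y₀ := y₀)
  have hbase' : ∀ {u : EuclideanSpace ℝ (Fin 2)}, u ∈ (extChartAt (𝓡 2) y₀).target →
      (extChartAt (𝓡 2) y₀).symm u ∈ (trivializationAt (EuclideanSpace ℝ (Fin 2)) (TangentSpace (𝓡
          2) : S → Type _) y₀).baseSet := fun hu ↦ by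
    rw [TangentBundle.trivializationAt_baseSet, ← extChartAt_source (𝓡 2)]
    exact (extChartAt (𝓡 2) y₀).map_target hu
  -- the formula near `q`
  have hformula : (fun q' : ℝ × EuclideanSpace ℝ (Fin 2) ↦
      Hf q'.1 ((extChartAt (𝓡 2) y₀).symm q'.2)) =ᶠ[𝓝 q]
      fun q' ↦ ∑ a', ∑ c, (Matrix.of fun a' c ↦ (ofRiemannian h).val (F q'.1 ((extChartAt (𝓡 2)
          y₀).symm q'.2))
        (mfderiv 𝓘(ℝ, ℝ × EuclideanSpace ℝ (Fin 2)) (𝓡 3)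
          (fun q : ℝ × EuclideanSpace ℝ (Fin 2) ↦ F q.1 ((extChartAt (𝓡 2) y₀).symm q.2)) q'
          ((0 : ℝ), b₂ a'))
        (mfderiv 𝓘(ℝ, ℝ × EuclideanSpace ℝ (Fin 2)) (𝓡 3)
          (fun q : ℝ × EuclideanSpace ℝ (Fin 2) ↦ F q.1 ((extChartAt (𝓡 2) y₀).symm q.2)) q'
          ((0 : ℝ), b₂ c)))⁻¹ c a' *
        (ofRiemannian h).secondFundamentalForm (𝓡 2) (F q'.1) (ν q'.1) ((extChartAt (𝓡 2) y₀).symm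
            q'.2)
          ((trivializationAt (EuclideanSpace ℝ (Fin 2)) (TangentSpace (𝓡 2) : S → Type _)
              y₀).localFrame b₂ a' ((extChartAt (𝓡 2) y₀).symm q'.2))
          ((trivializationAt (EuclideanSpace ℝ (Fin 2)) (TangentSpace (𝓡 2) : S → Type _)
              y₀).localFrame b₂ c ((extChartAt (𝓡 2) y₀).symm q'.2)) := by
    filter_upwards [hD.mem_nhds hq] with q' hq'
    obtain ⟨t, u⟩ := q'
    have ht : t ∈ Set.Ioo a b := hq'.1
    have hu : u ∈ (extChartAt (𝓡 2) y₀).target := hq'.2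
    have hFt : MDifferentiableAt (𝓡 2) (𝓡 3) (F t) ((extChartAt (𝓡 2) y₀).symm u) :=
      Hc.mdifferentiableAt_slice ht _
    have hPd : MDifferentiableAt 𝓘(ℝ, ℝ × EuclideanSpace ℝ (Fin 2)) (𝓡 3)
        (fun q : ℝ × EuclideanSpace ℝ (Fin 2) ↦ F q.1 ((extChartAt (𝓡 2) y₀).symm q.2)) (t, u) :=
      (hP.contMDiffAt (hD.mem_nhds hq')).mdifferentiableAt (by simp)
    dsimp only
    rw [hHf t ht, meanCurvature, trace_eq_sum_gram_inv _ _ ((trivializationAt (EuclideanSpace ℝ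
        (Fin 2)) (TangentSpace (𝓡 2) : S → Type _) y₀).basisAt b₂ (hbase' hu))]
    simp only [← (trivializationAt (EuclideanSpace ℝ (Fin 2)) (TangentSpace (𝓡 2) : S → Type _)
        y₀).localFrame_apply_of_mem_baseSet b₂ (hbase' hu), inducedMetric_val,
      inducedBilin_apply, mfderiv_localFrame_eq_mfderiv_chartFlow b₂ hu hFt hPd]
  refine ContMDiffAt.congr_of_eventuallyEq ?_ hformula
  -- the Gram matrix at `q` is invertible
  have hdet : (Matrix.of fun a' c ↦ (ofRiemannian h).val (F q.1 ((extChartAt (𝓡 2) y₀).symm q.2))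
      (mfderiv 𝓘(ℝ, ℝ × EuclideanSpace ℝ (Fin 2)) (𝓡 3)
        (fun q : ℝ × EuclideanSpace ℝ (Fin 2) ↦ F q.1 ((extChartAt (𝓡 2) y₀).symm q.2)) q
        ((0 : ℝ), b₂ a'))
      (mfderiv 𝓘(ℝ, ℝ × EuclideanSpace ℝ (Fin 2)) (𝓡 3)
        (fun q : ℝ × EuclideanSpace ℝ (Fin 2) ↦ F q.1 ((extChartAt (𝓡 2) y₀).symm q.2)) q
        ((0 : ℝ), b₂ c))).det ≠ 0 := by
    obtain ⟨t, u⟩ := q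
    have ht : t ∈ Set.Ioo a b := hq.1
    have hu : u ∈ (extChartAt (𝓡 2) y₀).target := hq.2
    have hFt : MDifferentiableAt (𝓡 2) (𝓡 3) (F t) ((extChartAt (𝓡 2) y₀).symm u) :=
      Hc.mdifferentiableAt_slice ht _
    have hPd : MDifferentiableAt 𝓘(ℝ, ℝ × EuclideanSpace ℝ (Fin 2)) (𝓡 3)
        (fun q : ℝ × EuclideanSpace ℝ (Fin 2) ↦ F q.1 ((extChartAt (𝓡 2) y₀).symm q.2)) (t, u) :=
      (hP.contMDiffAt (hD.mem_nhds hq)).mdifferentiableAt (by simp)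
    have h0 := det_gram_localFrame_ne_zero (trivializationAt (EuclideanSpace ℝ (Fin 2))
      (TangentSpace (𝓡 2) : S → Type _) y₀)
      ((ofRiemannian h).inducedMetric (F t) hpb (Hc.isSpacelikeImmersion t ht)) b₂ (hbase' hu)
    have hmat : (Matrix.of fun a' c ↦ (ofRiemannian h).val (F t ((extChartAt (𝓡 2) y₀).symm u))
        (mfderiv 𝓘(ℝ, ℝ × EuclideanSpace ℝ (Fin 2)) (𝓡 3)
          (fun q : ℝ × EuclideanSpace ℝ (Fin 2) ↦ F q.1 ((extChartAt (𝓡 2) y₀).symm q.2)) (t, u)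
          ((0 : ℝ), b₂ a'))
        (mfderiv 𝓘(ℝ, ℝ × EuclideanSpace ℝ (Fin 2)) (𝓡 3)
          (fun q : ℝ × EuclideanSpace ℝ (Fin 2) ↦ F q.1 ((extChartAt (𝓡 2) y₀).symm q.2)) (t, u)
          ((0 : ℝ), b₂ c))) =
        Matrix.of fun i j ↦ ((ofRiemannian h).inducedMetric (F t) hpb
          (Hc.isSpacelikeImmersion t ht)).val ((extChartAt (𝓡 2) y₀).symm u)
          ((trivializationAt (EuclideanSpace ℝ (Fin 2)) (TangentSpace (𝓡 2) : S → Type _)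
              y₀).localFrame
            b₂ i ((extChartAt (𝓡 2) y₀).symm u))
          ((trivializationAt (EuclideanSpace ℝ (Fin 2)) (TangentSpace (𝓡 2) : S → Type _)
              y₀).localFrame
            b₂ j ((extChartAt (𝓡 2) y₀).symm u)) := by
      ext i j
      rw [Matrix.of_apply, Matrix.of_apply, ← mfderiv_localFrame_eq_mfderiv_chartFlow b₂ hu hFt hPd
          i,
        ← mfderiv_localFrame_eq_mfderiv_chartFlow b₂ hu hFt hPd j]
      rfl
    dsimp only
    rw [hmat]
    exact h0
  refine ContMDiffAt.sum fun a' _ ↦ ContMDiffAt.sum fun c _ ↦ ?_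
  exact (contMDiffAt_matrix_inv (fun a' c ↦ Hc.contMDiffAt_gram_chartFlow b₂ hq a' c) hdet c a').mul
    (Hc.contMDiffAt_secondFundamentalForm_chartFlow b₂ hq a' c)

/-- **Joint `C^∞` regularity of the mean curvature in the charts of `S`** (the hypothesis `hreg`
of `IsClassicalIMCF.hasDerivAt_sqMeanCurvatureIntegral`, `GerochMonotonicityVariation.lean`):
for any representative `Hf` of the mean curvature on `(a, b)` and every `y₀ ∈ S`,
`(t, u) ↦ Hf t (φ_{y₀}⁻¹ u)` is `C^∞` on `(a, b) × φ_{y₀}.target`.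
[cite: HuiskenIlmanenIMCF2001, §0 (∗)] -/
theorem contDiffOn_meanCurvature_chart (Hc : IsClassicalIMCF h hpb F ν a b) (Hf : ℝ → S → ℝ)
    (hHf : ∀ t (ht : t ∈ Set.Ioo a b) (y : S), Hf t y =
      (ofRiemannian h).meanCurvature (F t) hpb (Hc.isSpacelikeImmersion t ht) (ν t) y) (y₀ : S) :
    ContDiffOn ℝ ∞ (fun q : ℝ × EuclideanSpace ℝ (Fin 2) ↦ Hf q.1 ((extChartAt (𝓡 2) y₀).symm q.2))
      (Set.Ioo a b ×ˢ (extChartAt (𝓡 2) y₀).target) :=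
  contMDiffOn_iff_contDiffOn.1 fun _ hq ↦
    (Hc.contMDiffAt_meanCurvature_chartFlow Hf hHf hq).contMDiffWithinAt

end IsClassicalIMCF

end Flow

end Literature.Geometry.Lorentzian

end
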